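import Mathlib
import HarnessLib
import Summits.HubbardSuperconductivity.HubbardSuperconductivity.Theorems.KLProgrammeC4aBubbleTubeRepGeneric

/-!
# Route `KLProgramme` — crux C4a, S3 brick (B3, REPRESENTATION) for MERELY CONTINUOUS data: the zone box → chart → level-integral chain for a continuous
# level profile and a continuous vertex factor, and its two-level-kernel form `∫ w⊗w·X = ∫_{−hi}^{hi} w(e) ∫ J(e,φ+θ)•(w(ē)X(e,ē)) dφ de`

Cell `gate-hubbard-kl`, seat hubbard-kl-k3c3-p3 (g38; row «implicit-function / monotonicity route for μ(n)»).  Located brick for the (C)-closer lane / the `M₁` assembly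
(stub (C) `stub_twoLeg_curvature` of `KLRegimeEngineV17F2`, stmt-HubbardSuperconductivity-20437), memo HOME/hubbard-kl-k3c3-p3/SWAP-BY-SYMMETRY.md.

WHY.  The (B3) representation of record (`…C4aBubbleTubeRepGeneric.tube_eq_levelIntegral_recentre`, `zoneBoxIco_profile_eq_levelIntegral`; c4a-1's
`tubeTadpole_eq_chart`) asks the vertex factor `W : Momentum → ℂ` to be `C^∞` — used only to get CONTINUITY of the chart-side integrand.  In the symmetric
organisation (`…C4aBubbleSwapSymmetry`) the vertex factor is `W(q̂) = w(e_K(S − q̂))·X(e_K q̂, e_K(S − q̂))` with `X ∈ {A_s, M_s, P, …}` JOINTLY CONTINUOUS but not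
known to be jointly smooth; and B-1 (xii) `…C4aFirstOrderTubePieceJoint.hasDerivAt_tubePiece_joint` starts from the interval/level form.  This file is the glue:
the chain re-proved from the RAW change of variables (`setIntegral_tube_eq_chart`, `setIntegral_box_shift_angle`, `tubeAngular_recentre`, `setIntegral_zoneBox_eq_tube`)
under continuity only.
* §1 `continuous_chartIntegrand_of_continuous` (strip device: continuous on the open tube, locally zero off it), `tubeTadpole_eq_chart_of_continuous`,
  **`tube_eq_levelIntegral_recentre_of_continuous`**, **`zoneBoxIco_profile_eq_levelIntegral_of_continuous`**, `zoneBoxIoo_profile_eq_levelIntegral_of_continuous`;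
* §2 two-level kernels: **`zoneBox_weightedKernel_eq_levelIntegral`** (`((∫_{(−π,π)²} w(e_K q̂)w(e_K(S−q̂))X(e_K q̂, e_K(S−q̂)) : ℝ) : ℂ)
  = ∫_{(−r,r)} w(e)·∫_{(−π,π)} J(e,φ+θ)•((w(ē)X(e,ē) : ℝ) : ℂ)`, `ē = e_K(S − Φ(e,φ+θ))`, the loop's own level read as `e` by `frameLevel_levelPoint`), and at the
  co-moving pair momentum `S = pairSumPath μ K ρ ϑ θ 0` on the level box `[−hi,hi] ⊇ tsupport w`:
  **`zoneBox_weightedKernel_pairSum_eq_tubePiece`** — LITERALLY the function differentiated by `hasDerivAt_tubePiece_joint` (kernel family `K e u := w(u)·X(e,u)`).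
So `coMovingJetsL1Theta_ppTrueKernel_of_pieces` (vertex functions) → this file → `hasDerivAt_tubePiece_joint` → `firstOrderLayer_abs_le` / `farPartner_firstOrderLayer_abs_le`
is a closed chain at order one, with the kernel rows of `…C4aKernelBumpRows[Weighted]`.
Measure-theoretic bookkeeping on landed objects; nothing about the model's sizes; nothing asserts (C), K3, the window or superconductivity.
References: FST II CPAM 51 (1998) §3 [cite: FeldmanSalmhoferTrubowitz1998]; BGM 2006 §2.4 (2.40) [cite: BenfattoGiulianiMastropietro2006].
-/

noncomputable section

namespace Summit.HubbardSuperconductivity.HubbardSuperconductivity.Theorems.C4a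

set_option linter.dupNamespace false -- summit = problem name (single-conjunct summit), D-0017

open Real Set Filter MeasureTheory
open scoped Topology ContDiff
open Literature.MathematicalPhysics.QuantumLattice Literature.MathematicalPhysics.QuantumLattice.BandSectorCounting Literature.Probability.LatticeModels
open Summit.HubbardSuperconductivity.HubbardSuperconductivity.Theorems.KLRegimeSplit
open Summit.HubbardSuperconductivity.HubbardSuperconductivity.Theorems.DispersionFlow
open Summit.HubbardSuperconductivity.HubbardSuperconductivity.Theorems.PerturbedFermiCurve

/-! ## §1 The chain for continuous data -/

section Rep

variable {a b : ℝ} (B : BandBounds a b) {K : TrigPolyC4v} {A : ℝ}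
  (hA : ∀ p : Momentum, ∀ j ≤ 2, ‖iteratedFDeriv ℝ j (frameShift K) p‖ ≤ A) (hADt : 2 * A < B.Dtmin)
  {μ r : ℝ} (hlo : a < μ - r - A) (hhi : μ + r + A < b)
include B hA hADt hlo hhi

/-- **Global continuity of the chart-side integrand for continuous data**: `p ↦ f(ρ)·(J(p) • W(Φ(ρ,ϑ)))` is continuous on `ℝ²` when `f` is continuous with
`tsupport f ⊆ (−r, r)` and `W` is continuous (continuous on the open tube, locally zero off it). -/
theorem continuous_chartIntegrand_of_continuous {f : ℝ → ℂ} (hf : Continuous f) (hfsupp : tsupport f ⊆ Ioo (-r) r)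
    {W : Momentum → ℂ} (hW : Continuous W) :
    Continuous fun p : ℝ × ℝ => f p.1 * (levelChartJac μ K p • W (levelPoint μ K p.1 p.2)) := by
  set U : Set (ℝ × ℝ) := {ρ : ℝ | |ρ| < r} ×ˢ univ with hU
  have hUo : IsOpen U := (isOpen_lt continuous_abs continuous_const).prod isOpen_univ
  have hon : ContinuousOn (fun p : ℝ × ℝ => f p.1 * (levelChartJac μ K p • W (levelPoint μ K p.1 p.2))) U :=
    ((hf.comp continuous_fst).continuousOn).mul
      ((contDiffOn_levelChartJac B hA hADt hlo hhi).continuousOn.smul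
        (hW.comp_continuousOn (contDiffOn_levelPoint B hA hADt hlo hhi (m := 0)).continuousOn))
  refine continuous_iff_continuousAt.2 fun p => ?_
  by_cases hp : p ∈ U
  · exact hon.continuousAt (hUo.mem_nhds hp)
  · have hρ : p.1 ∉ tsupport f := fun h => hp (by
      have h' := hfsupp h
      exact mk_mem_prod (abs_lt.2 ⟨h'.1, h'.2⟩) (mem_univ _))
    have hev : f =ᶠ[𝓝 p.1] 0 := notMem_tsupport_iff_eventuallyEq.mp hρ
    have hev' : ∀ᶠ q in 𝓝 p, f q.1 = 0 := continuous_fst.continuousAt.eventually hev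
    have hzero : (fun q : ℝ × ℝ => f q.1 * (levelChartJac μ K q • W (levelPoint μ K q.1 q.2))) =ᶠ[𝓝 p] fun _ => 0 := by
      filter_upwards [hev'] with q hq
      simp only [hq, zero_mul]
    exact (continuousAt_congr hzero).2 continuousAt_const

/-- **Tube → chart, continuous data**: `∫_{tube} f(e_K q̂)·W(q̂) dq = ∫_{(−r,r)×(0,2π]} f(ρ)·(J(ρ,ϑ) • W(Φ(ρ,ϑ)))`. -/
theorem tubeTadpole_eq_chart_of_continuous {f : ℝ → ℂ} (hf : Continuous f) (hfsupp : tsupport f ⊆ Ioo (-r) r)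
    {W : Momentum → ℂ} (hW : Continuous W) :
    ∫ q in {q : ℝ × ℝ | |q.1| < π ∧ |q.2| < π ∧ |frameLevel μ K (WithLp.toLp 2 ![q.1, q.2])| < r},
        f (frameLevel μ K (WithLp.toLp 2 ![q.1, q.2])) * W (WithLp.toLp 2 ![q.1, q.2]) =
      ∫ p in Ioo (-r) r ×ˢ Ioc 0 (2 * π), f p.1 * (levelChartJac μ K p • W (levelPoint μ K p.1 p.2)) := by
  rw [setIntegral_tube_eq_chart B hA hADt hlo hhi]
  have hbox : ∀ p ∈ Ioo (-r) r ×ˢ Ioc (-π) π,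
      (perturbedFermiRadius (fun k : Fin 2 → ℝ => -K.eval k) (μ + p.1) p.2 *
          deriv (fun m : ℝ => perturbedFermiRadius (fun k : Fin 2 → ℝ => -K.eval k) m p.2) (μ + p.1)) •
        (f (frameLevel μ K (WithLp.toLp 2 ![(levelChart μ K p).1, (levelChart μ K p).2])) *
          W (WithLp.toLp 2 ![(levelChart μ K p).1, (levelChart μ K p).2])) =
      f p.1 * (levelChartJac μ K p • W (levelPoint μ K p.1 p.2)) := by
    intro p hp
    have hp1 : p.1 ∈ Ioo (-r) r := (mem_prod.1 hp).1
    have h1 : a ≤ μ + p.1 - A := by linarith [hp1.1]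
    have h2 : μ + p.1 + A ≤ b := by linarith [hp1.2]
    rw [toLp_vec_levelChart, frameLevel_levelPoint B hA h1 h2, ← levelChartJac_apply, mul_smul_comm]
  rw [setIntegral_congr_fun (measurableSet_Ioo.prod measurableSet_Ioc) hbox]
  have hcont := continuous_chartIntegrand_of_continuous B hA hADt hlo hhi hf hfsupp hW
  have hper : ∀ ρ, Function.Periodic (fun ϑ => f (ρ, ϑ).1 * (levelChartJac μ K (ρ, ϑ) • W (levelPoint μ K (ρ, ϑ).1 (ρ, ϑ).2))) (2 * π) := by
    intro ρ ϑ
    simp only [levelChartJac_periodic μ K ρ ϑ, levelPoint_periodic μ K ρ ϑ]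
  have hK : ∀ s t : ℝ, IntegrableOn (fun p : ℝ × ℝ => f p.1 * (levelChartJac μ K p • W (levelPoint μ K p.1 p.2))) (Ioo (-r) r ×ˢ Ioc s t) :=
    fun s t => (hcont.continuousOn.integrableOn_compact (isCompact_Icc.prod isCompact_Icc)).mono_set (prod_mono Ioo_subset_Icc_self Ioc_subset_Icc_self)
  exact setIntegral_box_shift_angle hper (hK _ _) (hK _ _)

/-- **THE TUBE PIECE AS A LEVEL INTEGRAL, continuous data**: `∫_{tube} f(e_K q̂)·W(q̂) dq = ∫_{(−r,r)} f(e)·∫_{(−π,π)} J(e,φ+θ)•W(Φ(e,φ+θ)) dφ de`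
for every recentring angle `θ`. -/
theorem tube_eq_levelIntegral_recentre_of_continuous {f : ℝ → ℂ} (hf : Continuous f) (hfsupp : tsupport f ⊆ Ioo (-r) r)
    {W : Momentum → ℂ} (hW : Continuous W) (θ : ℝ) :
    ∫ q in {q : ℝ × ℝ | |q.1| < π ∧ |q.2| < π ∧ |frameLevel μ K (WithLp.toLp 2 ![q.1, q.2])| < r},
        f (frameLevel μ K (WithLp.toLp 2 ![q.1, q.2])) * W (WithLp.toLp 2 ![q.1, q.2]) =
      ∫ e in Ioo (-r) r, f e * ∫ φ in Ioo (-π) π, levelChartJac μ K (e, φ + θ) • W (levelPoint μ K e (φ + θ)) := by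
  rw [tubeTadpole_eq_chart_of_continuous B hA hADt hlo hhi hf hfsupp hW]
  have hcont := continuous_chartIntegrand_of_continuous B hA hADt hlo hhi hf hfsupp hW
  have hprod : IntegrableOn (fun p : ℝ × ℝ => f p.1 * (levelChartJac μ K p • W (levelPoint μ K p.1 p.2))) (Ioo (-r) r ×ˢ Ioc 0 (2 * π)) :=
    (hcont.continuousOn.integrableOn_compact (isCompact_Icc.prod isCompact_Icc)).mono_set (prod_mono Ioo_subset_Icc_self Ioc_subset_Icc_self)
  rw [Measure.volume_eq_prod] at hprod ⊢
  rw [setIntegral_prod _ hprod]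
  refine setIntegral_congr_fun measurableSet_Ioo fun e _ => ?_
  show (∫ ϑ in Ioc 0 (2 * π), f (e, ϑ).1 * (levelChartJac μ K (e, ϑ) • W (levelPoint μ K (e, ϑ).1 (e, ϑ).2))) = _
  simp only
  rw [integral_const_mul, tubeAngular_recentre (μ := μ) (K := K) W e θ]

/-- **Zone box (`Ico` form) → level integral in one call, continuous data.** -/
theorem zoneBoxIco_profile_eq_levelIntegral_of_continuous {f : ℝ → ℂ} (hf : Continuous f) (hfsupp : tsupport f ⊆ Ioo (-r) r)
    {W : Momentum → ℂ} (hW : Continuous W) (θ : ℝ) :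
    ∫ p in Ico (-π) π ×ˢ Ico (-π) π, f (frameLevel μ K (WithLp.toLp 2 ![p.1, p.2])) * W (WithLp.toLp 2 ![p.1, p.2]) =
      ∫ e in Ioo (-r) r, f e * ∫ φ in Ioo (-π) π, levelChartJac μ K (e, φ + θ) • W (levelPoint μ K e (φ + θ)) := by
  rw [setIntegral_zoneBox_eq_tube μ K hfsupp W, tube_eq_levelIntegral_recentre_of_continuous B hA hADt hlo hhi hf hfsupp hW θ]

/-- **Zone box (`Ioo` form) → level integral in one call, continuous data** (the open box is the `Ico` box up to a null set). -/
theorem zoneBoxIoo_profile_eq_levelIntegral_of_continuous {f : ℝ → ℂ} (hf : Continuous f) (hfsupp : tsupport f ⊆ Ioo (-r) r)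
    {W : Momentum → ℂ} (hW : Continuous W) (θ : ℝ) :
    ∫ p in Ioo (-π) π ×ˢ Ioo (-π) π, f (frameLevel μ K (WithLp.toLp 2 ![p.1, p.2])) * W (WithLp.toLp 2 ![p.1, p.2]) =
      ∫ e in Ioo (-r) r, f e * ∫ φ in Ioo (-π) π, levelChartJac μ K (e, φ + θ) • W (levelPoint μ K e (φ + θ)) := by
  have hae : (Ioo (-π) π ×ˢ Ioo (-π) π : Set (ℝ × ℝ)) =ᵐ[volume] (Ico (-π) π ×ˢ Ico (-π) π : Set (ℝ × ℝ)) :=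
    Measure.set_prod_ae_eq (Ioo_ae_eq_Ico (μ := volume) (a := -π) (b := π)) (Ioo_ae_eq_Ico (μ := volume) (a := -π) (b := π))
  rw [setIntegral_congr_set hae]
  exact zoneBoxIco_profile_eq_levelIntegral_of_continuous B hA hADt hlo hhi hf hfsupp hW θ

/-! ## §2 Two-level kernels: the symmetric-cut-off zone integrals as tube pieces -/

/-- **A WEIGHTED TWO-LEVEL KERNEL ON THE ZONE BOX IS A TUBE PIECE**: for a continuous real weight `w` with `tsupport w ⊆ (−r, r)`, a jointly continuous real kernel
`X` and any pair momentum `S`,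
`((∫_{(−π,π)²} w(e_K q̂)·w(e_K(S−q̂))·X(e_K q̂, e_K(S−q̂)) dq̂ : ℝ) : ℂ) = ∫_{(−r,r)} w(e)·∫_{(−π,π)} J(e,φ+θ) • ((w(ē)·X(e,ē) : ℝ) : ℂ) dφ de`,
`ē = e_K(S − Φ(e,φ+θ))` — the loop's own level reads `e` on the chart (`frameLevel_levelPoint`). -/
theorem zoneBox_weightedKernel_eq_levelIntegral {w : ℝ → ℝ} (hw : Continuous w) (hwsupp : tsupport w ⊆ Ioo (-r) r)
    {X : ℝ → ℝ → ℝ} (hX : Continuous fun p : ℝ × ℝ => X p.1 p.2) (S : Momentum) (θ : ℝ) :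
    (((∫ p in Ioo (-π) π ×ˢ Ioo (-π) π, w (frameLevel μ K (WithLp.toLp 2 ![p.1, p.2])) * w (frameLevel μ K (S - WithLp.toLp 2 ![p.1, p.2])) *
        X (frameLevel μ K (WithLp.toLp 2 ![p.1, p.2])) (frameLevel μ K (S - WithLp.toLp 2 ![p.1, p.2])) : ℝ) : ℂ)) =
      ∫ e in Ioo (-r) r, ((w e : ℝ) : ℂ) * ∫ φ in Ioo (-π) π, (levelChartJac μ K (e, φ + θ) : ℝ) •
        (((w (frameLevel μ K (S - levelPoint μ K e (φ + θ))) * X e (frameLevel μ K (S - levelPoint μ K e (φ + θ)))) : ℝ) : ℂ) := by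
  have he : Continuous (frameLevel μ K) := (EngineV8.contDiff_frameLevel μ K (n := 0)).continuous
  -- the real zone integral as a complex one of the shape `f(e_K q̂)·W(q̂)`
  set f : ℝ → ℂ := fun e => ((w e : ℝ) : ℂ) with hfdef
  set W : Momentum → ℂ := fun q => (((w (frameLevel μ K (S - q)) * X (frameLevel μ K q) (frameLevel μ K (S - q))) : ℝ) : ℂ) with hWdef
  have hf : Continuous f := Complex.continuous_ofReal.comp hw
  have hfsupp : tsupport f ⊆ Ioo (-r) r := by
    refine (closure_mono fun e he' => ?_).trans hwsupp
    simp only [Function.mem_support, ne_eq, hfdef, Complex.ofReal_eq_zero] at he' ⊢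
    exact he'
  have hW : Continuous W := by
    refine Complex.continuous_ofReal.comp ?_
    exact ((hw.comp (he.comp (continuous_const.sub continuous_id))).mul
      (hX.comp ((he.comp continuous_id).prodMk (he.comp (continuous_const.sub continuous_id)))))
  have hcast : (((∫ p in Ioo (-π) π ×ˢ Ioo (-π) π, w (frameLevel μ K (WithLp.toLp 2 ![p.1, p.2])) * w (frameLevel μ K (S - WithLp.toLp 2 ![p.1, p.2])) *
        X (frameLevel μ K (WithLp.toLp 2 ![p.1, p.2])) (frameLevel μ K (S - WithLp.toLp 2 ![p.1, p.2])) : ℝ) : ℂ)) =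
      ∫ p in Ioo (-π) π ×ˢ Ioo (-π) π, (((w (frameLevel μ K (WithLp.toLp 2 ![p.1, p.2])) * w (frameLevel μ K (S - WithLp.toLp 2 ![p.1, p.2])) *
        X (frameLevel μ K (WithLp.toLp 2 ![p.1, p.2])) (frameLevel μ K (S - WithLp.toLp 2 ![p.1, p.2]))) : ℝ) : ℂ) :=
    integral_complex_ofReal.symm
  have hlhs : (∫ p in Ioo (-π) π ×ˢ Ioo (-π) π, (((w (frameLevel μ K (WithLp.toLp 2 ![p.1, p.2])) * w (frameLevel μ K (S - WithLp.toLp 2 ![p.1, p.2])) *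
        X (frameLevel μ K (WithLp.toLp 2 ![p.1, p.2])) (frameLevel μ K (S - WithLp.toLp 2 ![p.1, p.2]))) : ℝ) : ℂ)) =
      ∫ p in Ioo (-π) π ×ˢ Ioo (-π) π, f (frameLevel μ K (WithLp.toLp 2 ![p.1, p.2])) * W (WithLp.toLp 2 ![p.1, p.2]) := by
    refine setIntegral_congr_fun (measurableSet_Ioo.prod measurableSet_Ioo) fun p _ => ?_
    simp only [hfdef, hWdef]
    push_cast
    ring
  rw [hcast, hlhs, zoneBoxIoo_profile_eq_levelIntegral_of_continuous B hA hADt hlo hhi hf hfsupp hW θ]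
  refine setIntegral_congr_fun measurableSet_Ioo fun e he' => ?_
  have h1 : a ≤ μ + e - A := by linarith [he'.1]
  have h2 : μ + e + A ≤ b := by linarith [he'.2]
  simp only [hfdef, hWdef, frameLevel_levelPoint B hA h1 h2]

/-- **… AT THE CO-MOVING PAIR MOMENTUM, ON THE LEVEL BOX**: with `S = pairSumPath μ K ρ ϑ θ 0 = Φ(0,θ) + Φ(ρ,ϑ+θ)` and `tsupport w ⊆ (−hi, hi)`, `0 ≤ hi < r`, the zone
integral is LITERALLY the tube piece differentiated by `…C4aFirstOrderTubePieceJoint.hasDerivAt_tubePiece_joint` with the kernel family `K e u := w(u)·X(e,u)`: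
`((∫ w⊗w·X at S(θ) : ℝ) : ℂ) = ∫_{−hi}^{hi} w(e)·∫_{(−π,π)} J(e,φ+θ) • ((w(ē)X(e,ē) : ℝ) : ℂ) dφ de`, `ē = e_K(Φ(0,θ) + Φ(ρ,ϑ+θ) − Φ(e,φ+θ))`. -/
theorem zoneBox_weightedKernel_pairSum_eq_tubePiece {w : ℝ → ℝ} (hw : Continuous w) {hi : ℝ} (hhi0 : 0 ≤ hi) (hhir : hi < r)
    (hwsupp : tsupport w ⊆ Ioo (-hi) hi) {X : ℝ → ℝ → ℝ} (hX : Continuous fun p : ℝ × ℝ => X p.1 p.2) (ρ ϑ θ : ℝ) :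
    (((∫ p in Ioo (-π) π ×ˢ Ioo (-π) π, w (frameLevel μ K (WithLp.toLp 2 ![p.1, p.2])) *
        w (frameLevel μ K (pairSumPath μ K ρ ϑ θ 0 - WithLp.toLp 2 ![p.1, p.2])) *
        X (frameLevel μ K (WithLp.toLp 2 ![p.1, p.2])) (frameLevel μ K (pairSumPath μ K ρ ϑ θ 0 - WithLp.toLp 2 ![p.1, p.2])) : ℝ) : ℂ)) =
      ∫ e in (-hi)..hi, ((w e : ℝ) : ℂ) * ∫ φ in Ioo (-π) π, (levelChartJac μ K (e, φ + θ) : ℝ) •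
        (((w (frameLevel μ K (levelPoint μ K 0 θ + levelPoint μ K ρ (ϑ + θ) - levelPoint μ K e (φ + θ))) *
          X e (frameLevel μ K (levelPoint μ K 0 θ + levelPoint μ K ρ (ϑ + θ) - levelPoint μ K e (φ + θ)))) : ℝ) : ℂ) := by
  have hwsupp' : tsupport w ⊆ Ioo (-r) r := hwsupp.trans (Ioo_subset_Ioo (by linarith) hhir.le)
  rw [zoneBox_weightedKernel_eq_levelIntegral B hA hADt hlo hhi hw hwsupp' hX (pairSumPath μ K ρ ϑ θ 0) θ]
  simp only [pairSumPath, add_zero]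
  -- restrict the level integral to the box `[−hi, hi] ⊇ tsupport w`
  rw [intervalIntegral.integral_of_le (by linarith), integral_Ioc_eq_integral_Ioo]
  refine setIntegral_eq_of_subset_of_forall_sdiff_eq_zero measurableSet_Ioo (Ioo_subset_Ioo (by linarith) hhir.le) fun e he => ?_
  have hwe : w e = 0 := by
    have : e ∉ tsupport w := fun h => he.2 (hwsupp h)
    exact image_eq_zero_of_notMem_tsupport this
  rw [hwe, Complex.ofReal_zero, zero_mul]

end Rep

end Summit.HubbardSuperconductivity.HubbardSuperconductivity.Theorems.C4a

end
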